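import Summits.Ventures.Crystal3D.Bulk.CapCutD16
import Summits.Ventures.Crystal3D.Bulk.BulkOfTammes
import HarnessLib

/-!
# Cap-cut certificate `d16_u06035`: the Bulk corollary modulo (II) and the census

Venture `Crystal3D` (cell `pub-crystal3d`, phase 2; seat p3). One composition, kept apart from
`CapCutD16.lean` because the last step (`TammesBridge.bulkCrystallization3D_sharp_of_noHole`, via
`GapTuple 2.52` and the tree's verified kissing-configuration search) carries the 128 compiled
`KissingSearch.checkPart_eq_true_*` evaluations (`Lean.ofReduceBool`), whereas everything in
`CapCutD16.lean` closes on the standard axioms: «inequality (II) of the level-4 cap certificate + no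
fourteen-ball configuration with `CensusRows` and `intruderDist ∈ [1.207, 1.26]` ⇒
`BulkCrystallization3D 702`». HONEST FRAMING: a composition of existing sockets; no new mathematics.
-/

open Literature.Geometry.DiscreteGeometry.BachocVallentin

namespace Summit.Ventures.Crystal3D.CapCut

/-- **Bulk crystallization with the sharper constant, modulo (II) and the census**:
`BulkCrystallization3D 702` (axioms: standard + the tree's 128 `KissingSearch` compiled parts). [folklore] -/
theorem bulkCrystallization3D_sharp_of_ineqII_of_forall_censusRows
    (h2 : certD16.IneqII (1 / 2) lamD16)
    (hkill : ∀ c : Fin 14 → EuclideanSpace ℝ (Fin 3), CensusRows c →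
      (1.207 : ℝ) ≤ intruderDist c → False) :
    BulkCrystallization3D 702 :=
  TammesBridge.bulkCrystallization3D_sharp_of_noHole
    (noHole_063_of_ineqII_of_forall_censusRows h2 hkill)

end Summit.Ventures.Crystal3D.CapCut
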